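import Summits.RiemannHypothesis.RiemannHypothesis.Theorems.IntegerScrewDefs

/-!
# The PLANTED PAIR — common object of W-06 cycle 7 «DETECTION COST ATLAS» (CA114)/(CA116)

Definitions only (no theorem, no `sorry`): the zero multiset of `ζ` plus ONE planted off-line quadruple
`{1/2 ± δ ± iγ}` read on the screw side — `pairDefect δ γ` (the screw-function increment of the quadruple),
`plantedScrew δ γ = zetaScrew + pairDefect δ γ`, and its Gram matrix `plantedScrewMatrix δ γ n` on the integer
nodes `log 2, …, log (n+1)` (same indexing as the tree's `screwMatrix n = S_{n+1}`).  Bytes = rh-idea-2 g21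
`pub/ideators/rh-idea-2/g21/c26/Sketch-C2c6-v2.lean` (sha16 bbf764651e6c1e8c) l.23–35 VERBATIM, as carried in
rh-idea-6 g15 `c47/PlantedScrewBlind-rh-idea-6-g15.lean` (sha16 2fb99fa698da01a0) l.41–63; one tree copy that the
cycle-7 typed laws import (director-rh (CA116)).  The planted object is NOT `ζ`; nothing here bears on the truth of RH.
-/

noncomputable section

namespace RhIdea2G21.W06C6

open Literature.NumberTheory.LFunctions

/-- Screw-function DEFECT of the planted quadruple `{1/2 ± δ ± iγ}`:
`Q(t; δ, γ) = Σ_{w = ±δ ± iγ} (e^{w|t|} − 1)/w² = 2·Re[(e^{(δ+iγ)|t|} − 1)/(δ+iγ)²] + 2·Re[(e^{(−δ+iγ)|t|} − 1)/(−δ+iγ)²]`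
`= (4/γ²)(1 − cosh δ|t|·cos γ|t|) + O(δ/γ³)` = two on-line-type pair terms `4(1 − cos γt)/γ²` plus the
DEFECT `−(4/γ²)(cosh δ|t| − 1)·cos γ|t|`; `Q″(t) = 4 cosh(δt) cos(γt)` exactly (this def is the FULL sum). -/
noncomputable def pairDefect (δ γ t : ℝ) : ℝ :=
  2 * ((Complex.exp ((⟨δ, γ⟩ : ℂ) * (|t| : ℝ)) - 1) / ((⟨δ, γ⟩ : ℂ) ^ 2)).re
  + 2 * ((Complex.exp ((⟨-δ, γ⟩ : ℂ) * (|t| : ℝ)) - 1) / ((⟨-δ, γ⟩ : ℂ) ^ 2)).re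

/-- Model-A screw function: `Ψ_F = Ψ_ζ + Q(·; δ, γ)` (`zetaScrew` = the tree's prime-side Ψ of Suzuki2023 (1.1)). -/
noncomputable def plantedScrew (δ γ : ℝ) (t : ℝ) : ℝ :=
  zetaScrew t + pairDefect δ γ t

/-- Its screw Gram matrix on the integer nodes `log 2, …, log (n+1)` (same indexing as `screwMatrix n = S_{n+1}`). -/
noncomputable def plantedScrewMatrix (δ γ : ℝ) (n : ℕ) : Matrix (Fin n) (Fin n) ℝ :=
  Matrix.of fun i j =>
    plantedScrew δ γ (Real.log ((i : ℕ) + 2)) + plantedScrew δ γ (Real.log ((j : ℕ) + 2))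
      - plantedScrew δ γ (Real.log ((i : ℕ) + 2) - Real.log ((j : ℕ) + 2))

end RhIdea2G21.W06C6

end
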